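import Mathlib.LinearAlgebra.Matrix.Determinant.Basic
import Mathlib.LinearAlgebra.Matrix.ToLin
import Mathlib.Algebra.CharP.Two
import Mathlib.Data.Matrix.Basis
import Mathlib.LinearAlgebra.StdBasis
import Mathlib.Topology.Instances.ZMod
import Literature.NumberTheory.DiophantineGeometry.GenusTwoTwoTorsionS5b
import Literature.NumberTheory.GaloisRepresentations.ResidualGaloisRep
import HarnessLib

/-!
# `s5bMatrix` is a faithful representation `S₅ → Sp₄(𝔽₂)`; involutions of `A₅` (proofs)

Topic `Literature/NumberTheory/DiophantineGeometry`; `…Proofs` companion (theorems only) of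
`GenusTwoTwoTorsionS5b.lean` (`s5bMatrix`: the point stabiliser `S₅(b) ⊂ S₆ ≅ Sp₄(𝔽₂)` acting on
`U⁰/L`, Boxer–Calegari–Gee–Pilloni 2025, §8.1).  Certificates for the faithfulness of the image conditions written with `s5bMatrix` (Thm. 8.3.2 (1)–(2),
Lemma 9.4.2 (2)(d) of Boxer–Calegari–Gee–Pilloni 2025): `σ ↦ s5bMatrix σ` is MULTIPLICATIVE (it is the
matrix of `S₅(b)` on `U⁰/L = 𝔽₂⁵/⟨(1,…,1)⟩`: `s5bMatrix σ *ᵥ x` is "extend `x` by `0`, permute the five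
coordinates by `σ`, read off modulo the all-ones vector", `s5bMatrix_mulVec`), INJECTIVE, and preserves
the Gram matrix `G = (1 + δ_{ij}) = (⟨u_i, u_j⟩)` of the form induced by `Σ x_k y_k` on the basis
`u_i = [δ_i + δ₅]` (`⟨δ_i + δ₅, δ_j + δ₅⟩ = δ_{ij} + 1`), which is non-degenerate — so the image of
`S₅` is a subgroup of `Sp₄(𝔽₂) ≅ S₆` isomorphic to `S₅` containing the images of transpositions, which
are transvections `x ↦ x + ⟨x, δ_i + δ_j⟩ (δ_i + δ_j)` of `U⁰/L` (`s5bMatrix_swap_sub_one_eq`: `s5bMatrix (0 1) - 1`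
is the rank-one matrix supported on `{0,1} × {0,1}`) — i.e. the point-stabiliser copy `S₅(b)` (the transitive `S₅(a) ≅ PGL₂(𝔽₅)`
contains no transposition of `S₆`).  Finally, on `S₅` the cycle type `{2,2}` (the class `(**)(**)` of
`S₆` inside `S₅(b)`) is EXACTLY "even, of order `2`": the involutions of `A₅` are the double
transpositions — the translation used for hypothesis (2) of Thm. 8.3.2 ("the image of complex conjugation
has order `2` and lands in `A₅(b)`").

Three of the statements quantify over the `120` elements of `S₅` and are settled by `decide` (kernel
evaluation, a few seconds each, `maxRecDepth 8000`); multiplicativity is proved from the action formula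
(the `14400` pairs are out of reach of `decide`).

Part 2 (`section AbsolutelyIrreducible`) certifies Lemma 8.1.1 of loc. cit. for this model of `V`
("`V ⊗ 𝔽̄₂` is the unique `4`-dimensional irreducible `𝔽̄₂[A₅]`-module"): every elementary matrix `E_{ij}` is
an explicit sum of FOUR matrices `s5bMatrix σ` with `σ` even, so the `𝔽₂`-span of `A₅(b)` in `End(V) = M₄(𝔽₂)` is
everything (`span_s5bMatrix_even_eq_top`, Burnside), no extension of scalars produces an `A₅(b)`-stable subspace
(`eq_bot_or_eq_top_of_forall_even_map_s5bMatrix_mulVec_mem`), and any `σ : G →* GL₄(𝔽₂)` (resp. framed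
`ρ : G →ₜ* GL₄(𝔽₂)`) whose image contains `A₅(b)` is absolutely irreducible in the tree's sense
(`IsAbsIrreducible`, `FramedRep.IsAbsolutelyIrreducible`).  This is the residual irreducibility "even modulo
`p`" (`p = 2`) of §1.8.10 of loc. cit. ("if `π` is regular algebraic and not of general type, then the Galois
representations `ρ_{π,p}` … are reducible … we will always be in a situation where our Galois representations
are irreducible (even irreducible modulo `p`)") and Remark 1.8.9 ("this `π` will be of general type, and thus
transfers to a `C`-algebraic cuspidal automorphic representation of `GL₄`"): for the abelian surfaces of
Thm. 8.3.2 (hypothesis (1): `A₅(b) ⊆ im ρ̄_{A,2}`) and of Lemma 9.4.2 ((2)(d): `im ρ̄_{B,2} = S₅(b)`) it is what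
makes the modularity conclusion a single CUSPIDAL automorphic representation of `GL₄(𝔸_ℚ)` — the shape of the
last clause of `bcgp_switch_exists_modular_abelianSurface` (this directory).

## References

* G. Boxer, F. Calegari, T. Gee, V. Pilloni, *Modularity theorems for abelian surfaces* (arXiv:2502.20645,
  2025), §8.1 (`A[2] ≅ U⁰/L`, the Weil pairing inherited from `U`, `S₅(b)`, `A₅(b)`, Lemma 8.1.1),
  Thm. 8.3.2 (1)–(2), Lemma 9.4.2 (2)(d), proof of Thm. 9.5.2; Lemma 8.1.1 (`V ⊗ 𝔽̄₂` irreducible),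
  §1.8.10 and Remark 1.8.9 (general type, transfer to `GL₄`). [BoxerCalegariGeePilloni2025]
-/

namespace Literature.NumberTheory.DiophantineGeometry

open Matrix Equiv

section Faithful

/-- The action behind `s5bMatrix`: for `x ∈ 𝔽₂⁴` let `x̃ = (x, 0) ∈ 𝔽₂⁵` (`Fin.snoc x 0`); then
`(s5bMatrix σ · x)_i = x̃_{σ⁻¹ i} + x̃_{σ⁻¹ 4}` — permute the coordinates of `x̃` by `σ` and reduce modulo
the all-ones vector by subtracting the last coordinate (the model `U⁰/L|_{S₅(b)} = 𝔽₂⁵/⟨(1,…,1)⟩`).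
[cite: BoxerCalegariGeePilloni2025, §8.1 (A[2] ≅ U⁰/L)] -/
theorem s5bMatrix_mulVec (σ : Perm (Fin 5)) (x : Fin 4 → ZMod 2) (i : Fin 4) :
    (s5bMatrix σ *ᵥ x) i =
      (Fin.snoc x 0 : Fin 5 → ZMod 2) (σ.symm i.castSucc) +
        (Fin.snoc x 0 : Fin 5 → ZMod 2) (σ.symm (Fin.last 4)) := by
  have hsnoc : ∀ k : Fin 5,
      (Fin.snoc x 0 : Fin 5 → ZMod 2) k = ∑ j : Fin 4, if j.castSucc = k then x j else 0 := by
    intro k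
    induction k using Fin.lastCases with
    | last =>
        rw [Fin.snoc_last]
        refine (Finset.sum_eq_zero fun j _ => ?_).symm
        rw [if_neg (Fin.castSucc_lt_last j).ne]
    | cast j₀ =>
        rw [Fin.snoc_castSucc]
        simp only [Fin.castSucc_inj]
        rw [Finset.sum_ite_eq' Finset.univ j₀ x, if_pos (Finset.mem_univ _)]
  rw [hsnoc, hsnoc, ← Finset.sum_add_distrib]
  simp only [Matrix.mulVec, dotProduct]
  refine Finset.sum_congr rfl fun j _ => ?_
  rw [s5bMatrix_apply]
  have hA : j.castSucc = σ.symm i.castSucc ↔ σ j.castSucc = i.castSucc := Equiv.eq_symm_apply σ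
  have hB : j.castSucc = σ.symm (Fin.last 4) ↔ σ j.castSucc = Fin.last 4 := Equiv.eq_symm_apply σ
  simp only [hA, hB]
  by_cases h₁ : σ j.castSucc = i.castSucc
  · have h₂ : σ j.castSucc ≠ Fin.last 4 := by rw [h₁]; exact (Fin.castSucc_lt_last i).ne
    rw [if_pos (Or.inl h₁), one_mul, if_pos h₁, if_neg h₂, add_zero]
  · by_cases h₂ : σ j.castSucc = Fin.last 4
    · rw [if_pos (Or.inr h₂), one_mul, if_neg h₁, if_pos h₂, zero_add]
    · rw [if_neg (not_or.mpr ⟨h₁, h₂⟩), zero_mul, if_neg h₁, if_neg h₂, add_zero]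

/-- The same formula, extended to the phantom fifth coordinate: writing `y = s5bMatrix τ · x`,
`ỹ_k = x̃_{τ⁻¹ k} + x̃_{τ⁻¹ 4}` for ALL `k ≤ 4` (at `k = 4` both sides vanish, `2 = 0`). [folklore] -/
private theorem snoc_s5bMatrix_mulVec (τ : Perm (Fin 5)) (x : Fin 4 → ZMod 2) (k : Fin 5) :
    (Fin.snoc (s5bMatrix τ *ᵥ x) 0 : Fin 5 → ZMod 2) k =
      (Fin.snoc x 0 : Fin 5 → ZMod 2) (τ.symm k) +
        (Fin.snoc x 0 : Fin 5 → ZMod 2) (τ.symm (Fin.last 4)) := by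
  induction k using Fin.lastCases with
  | last => rw [Fin.snoc_last, CharTwo.add_self_eq_zero]
  | cast i => rw [Fin.snoc_castSucc, s5bMatrix_mulVec]

/-- **`s5bMatrix` is multiplicative**: `σ ↦ s5bMatrix σ` is a representation `S₅ → GL₄(𝔽₂)` (the
`4`-dimensional module `V = 𝔽₂⁵/⟨(1,…,1)⟩` of `S₅(b)`, loc. cit. §8.1).  From `s5bMatrix_mulVec`:
`(σ τ)⁻¹ = τ⁻¹ σ⁻¹` and `2 x̃_{τ⁻¹ 4} = 0`. [cite: BoxerCalegariGeePilloni2025, §8.1 (U⁰/L as an S₅(b)-, A₅(b)-module; Lemma 8.1.1)] -/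
theorem s5bMatrix_mul (σ τ : Perm (Fin 5)) : s5bMatrix (σ * τ) = s5bMatrix σ * s5bMatrix τ := by
  apply (Matrix.toLin' : Matrix (Fin 4) (Fin 4) (ZMod 2) ≃ₗ[ZMod 2] _).injective
  rw [Matrix.toLin'_mul]
  refine LinearMap.ext fun x => funext fun i => ?_
  simp only [Matrix.toLin'_apply, LinearMap.comp_apply]
  rw [s5bMatrix_mulVec (σ * τ), s5bMatrix_mulVec σ, snoc_s5bMatrix_mulVec, snoc_s5bMatrix_mulVec]
  have hk : ∀ k, (σ * τ).symm k = τ.symm (σ.symm k) := fun k => by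
    rw [Equiv.symm_apply_eq, Equiv.Perm.mul_apply, Equiv.apply_symm_apply, Equiv.apply_symm_apply]
  rw [hk, hk, add_add_add_comm, CharTwo.add_self_eq_zero, add_zero]

set_option maxRecDepth 8000 in
/-- Only the identity of `S₅` acts trivially on `V` (checked on the `120` elements). [folklore] -/
theorem eq_one_of_s5bMatrix_eq_one : ∀ σ : Perm (Fin 5), s5bMatrix σ = 1 → σ = 1 := by
  decide

/-- **`s5bMatrix` is injective**: `V` is a faithful `S₅(b)`-module, so a Galois image written with
`s5bMatrix` is a copy of the corresponding subgroup of `S₅`. [cite: BoxerCalegariGeePilloni2025, §8.1] -/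
theorem s5bMatrix_injective : Function.Injective s5bMatrix := by
  intro σ τ h
  have h1 : s5bMatrix (σ * τ⁻¹) = 1 := by
    rw [s5bMatrix_mul, h, ← s5bMatrix_mul, mul_inv_cancel, s5bMatrix_one]
  exact mul_inv_eq_one.mp (eq_one_of_s5bMatrix_eq_one _ h1)

set_option maxRecDepth 8000 in
/-- **`s5bMatrix` lands in `Sp₄(𝔽₂)`**: every `s5bMatrix σ` preserves the Gram matrix
`G_{ij} = ⟨u_i, u_j⟩ = 1 + δ_{ij}` (`0` on the diagonal, `1` off it) of the alternating form induced on
`U⁰/L` by `Σ x_k y_k` in the basis `u_i = [δ_i + δ₅]` — the Weil pairing of `A[2]` under `A[2] ≅ U⁰/L`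
(checked on the `120` elements). [cite: BoxerCalegariGeePilloni2025, §8.1 ("the Weil pairing is the pairing inherited from U")] -/
theorem transpose_s5bMatrix_mul_gram_mul_s5bMatrix : ∀ σ : Perm (Fin 5),
    (s5bMatrix σ)ᵀ * Matrix.of (fun i j : Fin 4 => if i = j then (0 : ZMod 2) else 1) * s5bMatrix σ =
      Matrix.of (fun i j : Fin 4 => if i = j then (0 : ZMod 2) else 1) := by
  decide

/-- The Gram matrix `G = (1 + δ_{ij})` is non-degenerate (`det G = 1` in `𝔽₂`), so `Sp(G) ≅ Sp₄(𝔽₂)`. [folklore] -/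
theorem det_gram_s5b :
    Matrix.det (Matrix.of fun i j : Fin 4 => if i = j then (0 : ZMod 2) else 1) = 1 := by
  decide

set_option maxRecDepth 8000 in
/-- The transposition `(0 1)` acts on `V = U⁰/L` by a TRANSVECTION: `s5bMatrix (0 1) - 1` is the rank-one
matrix `(u₀ + u₁) ⊗ (u₀ + u₁)ᵀ` (entries `1` exactly on `{0,1} × {0,1}`), i.e. `x ↦ x + (x₀ + x₁)(u₀ + u₁)` with
`u₀ + u₁ = [δ₀ + δ₁]`, matching "`x ↦ x + ⟨x, δ₀ + δ₁⟩ (δ₀ + δ₁)`"; transpositions of `S₆` are the transvections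
of `Sp₄(𝔽₂)`, and they lie in the point stabiliser `S₅(b)`, not in the transitive `S₅(a)`.
[cite: BoxerCalegariGeePilloni2025, §8.1] -/
theorem s5bMatrix_swap_sub_one_eq :
    s5bMatrix (Equiv.swap (0 : Fin 5) 1) - 1 =
      Matrix.of fun i j : Fin 4 => if (i = 0 ∨ i = 1) ∧ (j = 0 ∨ j = 1) then (1 : ZMod 2) else 0 := by
  decide

set_option maxRecDepth 8000 in
/-- **Involutions of `A₅` are the double transpositions**: for `σ ∈ S₅`, `σ.cycleType = {2, 2}` (the class
`(**)(**)` of `S₆` met inside the point stabiliser `S₅(b)`, Lemma 9.4.2 (2)(d)) iff `σ` is even, non-trivial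
and `σ² = 1` ("has order `2` and lands in `A₅(b)`", Thm. 8.3.2 (2)) (checked on the `120` elements).
[cite: BoxerCalegariGeePilloni2025, Thm. 8.3.2 (2) and Lemma 9.4.2 (2)(d); proof of Thm. 9.5.2 ("(**)(**) is a non-trivial conjugacy class contained in A₅(b)")] -/
theorem cycleType_eq_two_two_iff : ∀ σ : Perm (Fin 5),
    σ.cycleType = {2, 2} ↔ (Equiv.Perm.sign σ = 1 ∧ σ ≠ 1 ∧ σ * σ = 1) := by
  decide

end Faithful

section AbsolutelyIrreducible

/-! ## Part 2 — `A₅(b) ↷ V` is absolutely irreducible (Lemma 8.1.1; the input to Remark 1.8.9 / §1.8.10)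

Boxer–Calegari–Gee–Pilloni 2025, §1.8.10: "if `π` is regular algebraic and not of general type, then the Galois
representations `ρ_{π,p}` are reducible … Since we will always be in a situation where our Galois
representations are irreducible (even irreducible modulo `p`), we will only need to consider `π` of general
type", and Remark 1.8.9: "This `π` will be of general type, and thus transfers to a `C`-algebraic cuspidal
automorphic representation of `GL₄`."  For the abelian surfaces of Thm. 8.3.2 / Lemma 9.4.2 the residual
irreducibility is at `p = 2`: the image of `ρ̄_{B,2}` contains `A₅(b)`, and `A₅(b)` acts ABSOLUTELY IRREDUCIBLY on
`V = U⁰/L ≅ B[2]` (Lemma 8.1.1: "`V ⊗ 𝔽̄₂` is the unique `4`-dimensional irreducible `𝔽̄₂[A₅]`-module").  The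
theorems below certify this for the tree's model `s5bMatrix` of `V`: the `𝔽₂`-span of the `60` matrices
`s5bMatrix σ`, `σ` even, is all of `M₄(𝔽₂)` (each elementary matrix is an explicit sum of four of them), whence
(Burnside) no field extension produces an invariant subspace, and any framed `𝔽₂`-representation of any group
whose image contains these `60` matrices is absolutely irreducible in the sense of
`FramedRep.IsAbsolutelyIrreducible`. -/

/-- **Every elementary matrix is a sum of four elements of `A₅(b)`**: for all `i j ≤ 3` there are four EVEN
permutations `σ₀,…,σ₃ ∈ A₅(b)` with `Σ_k s5bMatrix σ_k = E_{ij}` in `M₄(𝔽₂)` (explicit witnesses, checked by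
`decide`).  This is the computational content of Lemma 8.1.1 of Boxer–Calegari–Gee–Pilloni 2025: the
`𝔽₂`-algebra spanned by `A₅(b)` inside `End(V) = M₄(𝔽₂)` is everything, see `span_s5bMatrix_even_eq_top` and
`eq_bot_or_eq_top_of_forall_even_map_s5bMatrix_mulVec_mem`. [cite: BoxerCalegariGeePilloni2025, Lemma 8.1.1] -/
theorem exists_even_sum_s5bMatrix_eq_single (i j : Fin 4) :
    ∃ σ : Fin 4 → Perm (Fin 5),
      (∀ k, Equiv.Perm.sign (σ k) = 1) ∧ ∑ k, s5bMatrix (σ k) = Matrix.single i j 1 := by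
  fin_cases i <;> fin_cases j
  -- E_00
  · exact ⟨![swap 0 1 * swap 3 4, swap 0 1 * swap 0 2, swap 0 1 * swap 0 2 * swap 0 4 * swap 0 3, swap 0 1 * swap 0 4], by decide, by decide⟩
  -- E_01
  · exact ⟨![1, swap 1 2 * swap 3 4, swap 1 4 * swap 1 3, swap 1 2 * swap 1 4], by decide, by decide⟩
  -- E_02
  · exact ⟨![1, swap 2 4 * swap 2 3, swap 1 2 * swap 3 4, swap 1 4 * swap 1 2], by decide, by decide⟩
  -- E_03
  · exact ⟨![1, swap 2 4 * swap 2 3, swap 1 3 * swap 1 4, swap 1 4 * swap 2 3], by decide, by decide⟩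
  -- E_10
  · exact ⟨![1, swap 0 2 * swap 3 4, swap 0 4 * swap 0 3, swap 0 2 * swap 0 4], by decide, by decide⟩
  -- E_11
  · exact ⟨![swap 1 2 * swap 3 4, swap 1 2 * swap 1 3, swap 0 1 * swap 0 2 * swap 0 4 * swap 0 3, swap 0 4 * swap 0 1 * swap 0 2 * swap 0 3], by decide, by decide⟩
  -- E_12
  · exact ⟨![1, swap 2 4 * swap 2 3, swap 0 2 * swap 3 4, swap 0 4 * swap 0 2], by decide, by decide⟩
  -- E_13
  · exact ⟨![1, swap 2 4 * swap 2 3, swap 0 3 * swap 0 4, swap 0 4 * swap 2 3], by decide, by decide⟩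
  -- E_20
  · exact ⟨![1, swap 0 1 * swap 3 4, swap 0 4 * swap 0 3, swap 0 1 * swap 0 4], by decide, by decide⟩
  -- E_21
  · exact ⟨![1, swap 1 4 * swap 1 3, swap 0 1 * swap 3 4, swap 0 4 * swap 0 1], by decide, by decide⟩
  -- E_22
  · exact ⟨![swap 2 3 * swap 2 4, swap 1 2 * swap 1 3, swap 0 4 * swap 2 3, swap 0 2 * swap 0 3 * swap 0 1 * swap 0 4], by decide, by decide⟩
  -- E_23
  · exact ⟨![1, swap 1 4 * swap 1 3, swap 0 3 * swap 0 4, swap 0 4 * swap 1 3], by decide, by decide⟩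
  -- E_30
  · exact ⟨![1, swap 0 1 * swap 2 4, swap 0 4 * swap 0 2, swap 0 1 * swap 0 4], by decide, by decide⟩
  -- E_31
  · exact ⟨![1, swap 1 4 * swap 1 2, swap 0 1 * swap 2 4, swap 0 4 * swap 0 1], by decide, by decide⟩
  -- E_32
  · exact ⟨![1, swap 1 4 * swap 1 2, swap 0 2 * swap 0 4, swap 0 4 * swap 1 2], by decide, by decide⟩
  -- E_33
  · exact ⟨![swap 2 4 * swap 2 3, swap 1 3 * swap 1 2, swap 0 4 * swap 2 3, swap 0 3 * swap 0 2 * swap 0 1 * swap 0 4], by decide, by decide⟩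

/-- **Burnside for `A₅(b) ↷ V`**: the `𝔽₂`-linear span of the matrices of the EVEN permutations (the image of
`A₅(b)` in `GL(V) = GL₄(𝔽₂)`) is all of `M₄(𝔽₂) = End(V)` — equivalently, `V` is an absolutely irreducible
`𝔽₂[A₅(b)]`-module (Lemma 8.1.1 of loc. cit.). [cite: BoxerCalegariGeePilloni2025, Lemma 8.1.1] -/
theorem span_s5bMatrix_even_eq_top :
    Submodule.span (ZMod 2) (s5bMatrix '' {σ | Equiv.Perm.sign σ = 1}) = ⊤ := by
  have hsingle : ∀ i j : Fin 4,
      Matrix.single i j (1 : ZMod 2) ∈ Submodule.span (ZMod 2) (s5bMatrix '' {σ | Equiv.Perm.sign σ = 1}) := by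
    intro i j
    obtain ⟨σ, hσ, hsum⟩ := exists_even_sum_s5bMatrix_eq_single i j
    rw [← hsum]
    exact Submodule.sum_mem _ fun k _ => Submodule.subset_span ⟨σ k, hσ k, rfl⟩
  refine eq_top_iff.2 fun M _ => ?_
  rw [Matrix.matrix_eq_sum_single M]
  refine Submodule.sum_mem _ fun i _ => Submodule.sum_mem _ fun j _ => ?_
  have h : Matrix.single i j (M i j) = M i j • Matrix.single i j (1 : ZMod 2) := by
    rw [Matrix.smul_single, smul_eq_mul, mul_one]
  rw [h]
  exact Submodule.smul_mem _ _ (hsingle i j)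

/-- **`A₅(b) ↷ V` is absolutely irreducible** (Boxer–Calegari–Gee–Pilloni 2025, Lemma 8.1.1, in the form used
in §1.8.10: "our Galois representations are irreducible (even irreducible modulo `p`) … we will only need to
consider `π` of general type"): for ANY field `K` and ring homomorphism `f : 𝔽₂ → K`, a `K`-subspace of `K⁴`
stable under the base-changed matrices `(s5bMatrix σ).map f`, `σ` even, is `⊥` or `⊤`.  Consequently a Galois
module `B[2]` whose image contains `A₅(b)` (Thm. 8.3.2 (1); Lemma 9.4.2 (2)(d): image `S₅(b)`) is absolutely
irreducible, so `ρ_{B,2}` is absolutely irreducible and the weight-`2` automorphic representation `π` of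
`GSp₄(𝔸_ℚ)` attached to `B` by Thm. 8.3.2 is of general type, hence transfers to a CUSPIDAL automorphic
representation of `GL₄(𝔸_ℚ)` (Remark 1.8.9, §1.8.10) — the shape of the modularity clause of
`bcgp_switch_exists_modular_abelianSurface`.
[cite: BoxerCalegariGeePilloni2025, Lemma 8.1.1, §1.8.10, Remark 1.8.9] -/
theorem eq_bot_or_eq_top_of_forall_even_map_s5bMatrix_mulVec_mem {K : Type*} [Field K]
    (f : ZMod 2 →+* K) (W : Submodule K (Fin 4 → K))
    (hW : ∀ σ : Perm (Fin 5), Equiv.Perm.sign σ = 1 → ∀ v ∈ W, ((s5bMatrix σ).map f) *ᵥ v ∈ W) :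
    W = ⊥ ∨ W = ⊤ := by
  classical
  rcases eq_or_ne W ⊥ with h | h
  · exact Or.inl h
  right
  obtain ⟨v, hvW, hv0⟩ := (Submodule.ne_bot_iff W).1 h
  obtain ⟨j, hj⟩ : ∃ j, v j ≠ 0 := Function.ne_iff.1 hv0
  -- every `E_{ij} ⊗ K` maps `v` into `W`
  have hE : ∀ i : Fin 4, (Matrix.single i j (1 : K)) *ᵥ v ∈ W := by
    intro i
    obtain ⟨σ, hσ, hsum⟩ := exists_even_sum_s5bMatrix_eq_single i j
    have hmap : Matrix.single i j (1 : K) = ∑ k, (s5bMatrix (σ k)).map f := by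
      have := congrArg f.mapMatrix hsum
      rw [map_sum] at this
      simpa [RingHom.mapMatrix_apply, Matrix.map_single, map_one] using this.symm
    rw [hmap, Matrix.sum_mulVec]
    exact Submodule.sum_mem _ fun k _ => hW (σ k) (hσ k) v hvW
  -- hence every standard basis vector lies in `W`
  have hbasis : ∀ i : Fin 4, (Pi.single i (1 : K) : Fin 4 → K) ∈ W := by
    intro i
    have h1 := hE i
    rw [Matrix.single_mulVec_eq, one_mul] at h1
    exact (Submodule.smul_mem_iff W hj).1 h1
  refine eq_top_iff.2 ?_
  rw [← (Pi.basisFun K (Fin 4)).span_eq]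
  refine Submodule.span_le.2 ?_
  rintro _ ⟨i, rfl⟩
  simpa [Pi.basisFun_apply] using hbasis i

/-- The same statement along the canonical map `𝔽₂ → K` of a field of characteristic `2`.
[cite: BoxerCalegariGeePilloni2025, Lemma 8.1.1] -/
theorem eq_bot_or_eq_top_of_forall_even_s5bMatrix_mulVec_mem {K : Type*} [Field K] [CharP K 2]
    (W : Submodule K (Fin 4 → K))
    (hW : ∀ σ : Perm (Fin 5), Equiv.Perm.sign σ = 1 →
      ∀ v ∈ W, ((s5bMatrix σ).map (ZMod.castHom (dvd_refl 2) K)) *ᵥ v ∈ W) :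
    W = ⊥ ∨ W = ⊤ :=
  eq_bot_or_eq_top_of_forall_even_map_s5bMatrix_mulVec_mem (ZMod.castHom (dvd_refl 2) K) W hW

open Literature.NumberTheory.GaloisRepresentations in
/-- **A mod-`2` representation whose image contains `A₅(b)` is absolutely irreducible.**  For any group `G`
and any `σ : G →* GL₄(𝔽₂)` such that every `s5bMatrix τ`, `τ` even, is a value of `σ` (i.e. `A₅(b) ⊆ σ(G)` in
the frame of `V = U⁰/L`: hypothesis "(1) `A₅(b) ⊆ ρ̄_{A,2}(G_ℚ)`" of Thm. 8.3.2, conclusion "(2)(d) image `S₅(b)`"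
of Lemma 9.4.2), `σ` is absolutely irreducible (`IsAbsIrreducible`: irreducible after every extension of
scalars `f : 𝔽₂ → k'`) — the residual irreducibility "even modulo `p`" (here `p = 2`) by which §1.8.10 /
Remark 1.8.9 of loc. cit. place the automorphic representation `π` of `B` in general type and transfer it to a
CUSPIDAL representation of `GL₄`.
[cite: BoxerCalegariGeePilloni2025, Lemma 8.1.1, Thm. 8.3.2 (1), Lemma 9.4.2 (2)(d), §1.8.10, Remark 1.8.9] -/
theorem _root_.Literature.NumberTheory.GaloisRepresentations.isAbsIrreducible_of_forall_even_exists_eq_s5bMatrix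
    {G : Type*} [Group G] (σ : G →* GL (Fin 4) (ZMod 2))
    (h : ∀ τ : Perm (Fin 5), Equiv.Perm.sign τ = 1 →
      ∃ g : G, ((σ g : GL (Fin 4) (ZMod 2)) : Matrix (Fin 4) (Fin 4) (ZMod 2)) = s5bMatrix τ) :
    IsAbsIrreducible σ := by
  intro k' _ f
  classical
  haveI : Nontrivial
      (Subrepresentation (glRepresentation ((Matrix.GeneralLinearGroup.map f).comp σ))) := by
    refine ⟨⟨⊥, ⊤, fun hbt ↦ ?_⟩⟩
    have h' := congrArg Subrepresentation.toSubmodule hbt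
    exact bot_ne_top (α := Submodule k' (Fin 4 → k')) h'
  refine ⟨fun S ↦ ?_⟩
  have hS : ∀ τ : Perm (Fin 5), Equiv.Perm.sign τ = 1 →
      ∀ v ∈ S.toSubmodule, ((s5bMatrix τ).map f) *ᵥ v ∈ S.toSubmodule := by
    intro τ hτ v hv
    obtain ⟨g, hg⟩ := h τ hτ
    have e : glRepresentation ((Matrix.GeneralLinearGroup.map f).comp σ) g v =
        ((s5bMatrix τ).map f) *ᵥ v := by
      rw [glRepresentation_apply_apply, MonoidHom.comp_apply, ← hg]
      rfl
    rw [← e]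
    exact S.apply_mem_toSubmodule g hv
  have hbot : (⊥ : Subrepresentation (glRepresentation ((Matrix.GeneralLinearGroup.map f).comp σ))).toSubmodule
      = ⊥ := rfl
  have htop : (⊤ : Subrepresentation (glRepresentation ((Matrix.GeneralLinearGroup.map f).comp σ))).toSubmodule
      = ⊤ := rfl
  rcases eq_bot_or_eq_top_of_forall_even_map_s5bMatrix_mulVec_mem f S.toSubmodule hS with hb | ht
  · exact Or.inl (Subrepresentation.toSubmodule_injective (hb.trans hbot.symm))
  · exact Or.inr (Subrepresentation.toSubmodule_injective (ht.trans htop.symm))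

open Literature.NumberTheory.GaloisRepresentations in
/-- Framed (continuous) form of `isAbsIrreducible_of_forall_even_exists_eq_s5bMatrix`: a framed mod-`2`
representation `ρ : G →ₜ* GL₄(𝔽₂)` of a topological group whose image contains `A₅(b)` (all `s5bMatrix τ`,
`τ` even) is absolutely irreducible in the sense of `FramedRep.IsAbsolutelyIrreducible`.
[cite: BoxerCalegariGeePilloni2025, Lemma 8.1.1, Thm. 8.3.2 (1), Lemma 9.4.2 (2)(d), §1.8.10] -/
theorem _root_.Literature.NumberTheory.GaloisRepresentations.FramedRep.isAbsolutelyIrreducible_of_forall_even_exists_eq_s5bMatrix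
    {G : Type*} [Group G] [TopologicalSpace G] (ρ : FramedRep G (ZMod 2) 4)
    (h : ∀ τ : Perm (Fin 5), Equiv.Perm.sign τ = 1 →
      ∃ g : G, ((ρ g : GL (Fin 4) (ZMod 2)) : Matrix (Fin 4) (Fin 4) (ZMod 2)) = s5bMatrix τ) :
    ρ.IsAbsolutelyIrreducible := by
  rw [FramedRep.isAbsolutelyIrreducible_iff_coe]
  exact isAbsIrreducible_of_forall_even_exists_eq_s5bMatrix (ρ : G →* GL (Fin 4) (ZMod 2)) fun τ hτ => h τ hτ

end AbsolutelyIrreducible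

end Literature.NumberTheory.DiophantineGeometry
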